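import Summits.KontsevichZagierPeriods.KontsevichZagierPeriods.Theses.FurushoPentagon
import Summits.KontsevichZagierPeriods.KontsevichZagierPeriods.Theorems.ReducedPeriodRing.Negative.RingForms
import Literature.NumberTheory.Transcendental.KZKernelConjectureForms
import Literature.NumberTheory.Transcendental.KZRulesAssociator

/-!
# `ReducedPeriodRing` (stmt-KontsevichZagierPeriods-3929) — the two halves of `Spec P`

Write `P = KZ.FormalPeriodRing`, `evalP : P →+* ℝ`, `𝔨 := ker evalP` (a prime: `P/𝔨 ↪ ℝ`) and
`𝔫 := nilradical P ⊆ 𝔨`. Conjecture 1 (kernel form, `KZKernelConjecture`) is `𝔨 = 0`; it splits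
EXACTLY into two abstractly independent halves:

* IRREDUCIBILITY `KernelIsNil`: `𝔨 ⊆ 𝔫` — every numerically vanishing formal period is NILPOTENT;
  equivalently `𝔫 = 𝔨`, i.e. `𝔨` is the unique minimal prime (every prime contains it,
  `kernelIsNil_iff_ker_le_primes`), i.e. every FIELD-valued (indeed every reduced-valued)
  realisation `χ : P → K` of the rules kills `𝔨`: `χ x` depends only on the VALUE `evalP x`
  (`kernelIsNil_iff_fieldPoints_factor`, `ker_evalP_le_ker_of_kernelIsNil`);
* REDUCEDNESS (the crux `ReducedPeriodRing`): `𝔫 = 0` — field-valued realisations SEPARATE the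
  elements of `P` (`Negative/RingForms.lean`, `reducedPeriodRing_iff_fieldPoints_separate`).

`kzKernelConjecture_iff_kernelIsNil_and_reduced`, `summit_iff_kernelIsNil_and_reduced`: the summit
is the conjunction; `dualNumber_model` / `product_model`: each half fails in a model of the other
(`ℚ[ε]`: every value-zero element nilpotent, not reduced; `ℚ × ℚ`: reduced, `(0,1)` value-zero and
idempotent). Reading for route FurushoPentagon: its mechanism (pentagon + group-likeness ⇒, by
Furusho 2011 Thm 1.2 at every field point, every double-shuffle defect is nilpotent) is an
irreducibility-half engine for specific elements; the crux is precisely the reducedness half that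
turns "nilpotent" into "zero", and nothing in the irreducibility half (transfers along
realisations, Furusho/Racinet-type theorems over fields) can substitute for it.
MOTIVIC PRECEDENT: for Nori's formal period algebra `𝒫̃(M) = O(X(M))`, which is SMOOTH
("X(M) is smooth because G(M) is a group scheme over a field of characteristic zero",
Huber–Müller-Stach, *Periods and Nori Motives*, 2015 draft Part III, after Def. 12.2.3), the
Grothendieck conjecture `ev` injective is equivalent to "the point `ev_M` of `Spec 𝒫̃(M)` is a
generic point, and `X(M)` connected" (loc. cit. Conj. 12.2.5 (1)⇔(2); Rem. 12.2.2: "Equivalently, we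
can conjecture that `𝒫̃(k)` is an integral domain and ev a generic point"). On the RULES side
smoothness is not available: its place in that equivalence is taken exactly by the crux, and
"ev generic on the reduction" is `KernelIsNil`.
cdisprove (refuter) file, cycle 2. [Kontsevich–Zagier 2001, §1.2, §4.1; Huber–Müller-Stach 2017,
§13.2 and 2015 draft III §12.2; Furusho 2011, Thm 1.2]
-/

noncomputable section

namespace Summit.KontsevichZagierPeriods.KontsevichZagierPeriods.ReducedPeriodRingNegative

open Literature.NumberTheory.Transcendental KZ
open Summit.KontsevichZagierPeriods.KontsevichZagierPeriods.Theses.FurushoPentagon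

/-! Throughout, the IRREDUCIBILITY HALF `KernelIsNil` is written out as
`∀ c : FormalRep, eval c = 0 → IsNilpotent (toFormalPeriod c)` (every formal combination of value
`0` has a nilpotent class in `P = FormalRep ⧸ relations`, i.e. `ker evalP ⊆ nilradical P`); it is
named `KernelIsNil` in the crux workfile `Cruxes/ReducedPeriodRing/Disproof.lean`. -/

/-- **Conjecture 1 = irreducibility ∧ reducedness**: the kernel form `eval c = 0 → c ∈ relations`
holds iff every value-zero class is nilpotent AND the crux `ReducedPeriodRing` holds. [folklore] -/
theorem kzKernelConjecture_iff_kernelIsNil_and_reduced :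
    KZKernelConjecture ↔
      (∀ c : FormalRep, eval c = 0 → IsNilpotent (toFormalPeriod c)) ∧ ReducedPeriodRing := by
  constructor
  · intro h
    refine ⟨fun c hc => ?_, fun c hc => h c (eval_eq_zero_of_sq_mem_relations hc)⟩
    rw [toFormalPeriod_eq_zero_of_mem (h c hc)]
    exact IsNilpotent.zero
  · rintro ⟨hN, hR⟩ c hc
    exact route_usage hR (hN c hc)

/-- The summit itself is the conjunction of the two halves. [folklore] -/
theorem summit_iff_kernelIsNil_and_reduced :
    KontsevichZagierPeriods ↔
      (∀ c : FormalRep, eval c = 0 → IsNilpotent (toFormalPeriod c)) ∧ ReducedPeriodRing :=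
  KontsevichZagierPeriods_iff.trans
    (kzKernelConjecture_iff_isRational.symm.trans kzKernelConjecture_iff_kernelIsNil_and_reduced)

/-- Under the crux, the summit is EXACTLY the irreducibility half (what remains to be proved once
`ReducedPeriodRing` is granted). [folklore] -/
theorem summit_iff_kernelIsNil_of_reduced (hR : ReducedPeriodRing) :
    KontsevichZagierPeriods ↔ (∀ c : FormalRep, eval c = 0 → IsNilpotent (toFormalPeriod c)) := by
  rw [summit_iff_kernelIsNil_and_reduced]
  exact ⟨fun h => h.1, fun h => ⟨h, hR⟩⟩

/-- Nilpotent formal periods have value `0` (`ℝ` is reduced): `nilradical P ≤ ker evalP`. [folklore] -/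
theorem nilradical_le_ker_evalP : nilradical FormalPeriodRing ≤ RingHom.ker evalP := by
  intro x hx
  rw [RingHom.mem_ker]
  exact ((mem_nilradical.mp hx).map evalP).eq_zero

/-- `KernelIsNil` says the nilradical of `P` IS the kernel of evaluation. [folklore] -/
theorem kernelIsNil_iff_nilradical_eq_ker :
    (∀ c : FormalRep, eval c = 0 → IsNilpotent (toFormalPeriod c)) ↔
      nilradical FormalPeriodRing = RingHom.ker evalP := by
  constructor
  · intro h
    refine le_antisymm nilradical_le_ker_evalP fun x hx => ?_
    obtain ⟨c, rfl⟩ := toFormalPeriod_surjective x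
    rw [RingHom.mem_ker, evalP_toFormalPeriod] at hx
    exact mem_nilradical.mpr (h c hx)
  · intro h c hc
    have hx : toFormalPeriod c ∈ RingHom.ker evalP := by
      rw [RingHom.mem_ker, evalP_toFormalPeriod]; exact hc
    rw [← h] at hx
    exact mem_nilradical.mp hx

/-- `KernelIsNil` says every prime ideal of `P` contains `ker evalP`, i.e. `ker evalP` is the
unique minimal prime: `Spec P` is irreducible with generic point the real-period point. [folklore] -/
theorem kernelIsNil_iff_ker_le_primes :
    (∀ c : FormalRep, eval c = 0 → IsNilpotent (toFormalPeriod c)) ↔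
      ∀ J : Ideal FormalPeriodRing, J.IsPrime → RingHom.ker evalP ≤ J := by
  rw [kernelIsNil_iff_nilradical_eq_ker]
  constructor
  · intro h J hJ
    rw [← h]
    haveI := hJ
    exact nilradical_le_prime J
  · intro h
    refine le_antisymm nilradical_le_ker_evalP ?_
    rw [nilradical_eq_sInf]
    exact le_sInf fun J hJ => h J hJ

/-- **The irreducibility half says the REDUCED formal period ring is already the ring of real
periods**: evaluation is injective on `P ⧸ nilradical P`. (The crux says `P` is its own
reduction; together: `evalP` injective.) [folklore] -/
theorem kernelIsNil_iff_injective_evalP_red :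
    (∀ c : FormalRep, eval c = 0 → IsNilpotent (toFormalPeriod c)) ↔
      Function.Injective (Ideal.Quotient.lift (nilradical FormalPeriodRing) evalP
        (fun _ hx => RingHom.mem_ker.mp (nilradical_le_ker_evalP hx))) := by
  rw [kernelIsNil_iff_nilradical_eq_ker]
  constructor
  · intro h
    exact RingHom.lift_injective_of_ker_le_ideal _ _ h.ge
  · intro h
    refine le_antisymm nilradical_le_ker_evalP fun x hx => ?_
    rw [← Ideal.Quotient.eq_zero_iff_mem]
    apply h
    rw [map_zero, Ideal.Quotient.lift_mk]
    exact RingHom.mem_ker.mp hx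

/-- **Under `KernelIsNil` every realisation of the rules into a REDUCED ring factors through the
value**: `evalP x = 0 → χ x = 0` (the image of a nilpotent in a reduced ring is `0`). So on the
irreducibility half, "realisations `χ` of the Kontsevich–Zagier rules into reduced commutative
rings" (the device of the route's rank-2 crux PentagonInKZ) are nothing but ring homomorphisms out
of the ring of real periods `evalP(P) ⊆ ℝ`. [folklore] -/
theorem ker_evalP_le_ker_of_kernelIsNil
    (h : (∀ c : FormalRep, eval c = 0 → IsNilpotent (toFormalPeriod c))) {R : Type*} [CommRing R] [IsReduced R]
    (χ : FormalPeriodRing →+* R) : RingHom.ker evalP ≤ RingHom.ker χ := by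
  intro x hx
  obtain ⟨c, rfl⟩ := toFormalPeriod_surjective x
  rw [RingHom.mem_ker, evalP_toFormalPeriod] at hx
  rw [RingHom.mem_ker]
  exact ((h c hx).map χ).eq_zero

/-- A realisation of the rules (additive, killing `relations`, multiplicative) takes the value
`(χ c)^(k+1)` on every formal combination whose class is `⟦c⟧^(k+1)`. [folklore] -/
theorem realisation_apply_of_toFormalPeriod_eq_pow {R : Type*} [CommRing R] (χ : FormalRep →+ R)
    (hrel : ∀ c ∈ relations, χ c = 0) (hmul : ∀ a b : FormalRep, χ (a * b) = χ a * χ b)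
    (c : FormalRep) :
    ∀ (k : ℕ) (d : FormalRep), toFormalPeriod d = toFormalPeriod c ^ (k + 1) → χ d = χ c ^ (k + 1) := by
  have hcongr : ∀ d d' : FormalRep, toFormalPeriod d = toFormalPeriod d' → χ d = χ d' := by
    intro d d' h
    have h0 : χ (d - d') = 0 := hrel _ (toFormalPeriod_eq_iff.mp h)
    rwa [map_sub, sub_eq_zero] at h0
  intro k
  induction k with
  | zero =>
    intro d hd
    rw [zero_add, pow_one] at hd ⊢
    exact hcongr d c hd
  | succ k ih =>
    intro d hd
    obtain ⟨d', hd'⟩ := toFormalPeriod_surjective (toFormalPeriod c ^ (k + 1))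
    have h1 : toFormalPeriod d = toFormalPeriod (c * d') := by
      rw [map_mul, hd', hd, ← pow_succ']
    rw [hcongr d _ h1, hmul, ih d' hd', ← pow_succ']

/-- **On the irreducibility half, realisations into REDUCED rings see only values**: if every
value-zero class is nilpotent, then every realisation `χ` of the Kontsevich–Zagier rules as in the
route's rank-2 crux PentagonInKZ (additive, killing `KZ.relations`, multiplicative for the Fubini
product) with reduced target satisfies `eval c = 0 → χ c = 0`; so the `χ`-valued regularised MZV
series is the image of the REAL one under a ring map out of the ring of real periods, and e.g. the
pentagon at reduced targets is then Drinfeld's real pentagon transported (not formalised).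
[folklore] -/
theorem realisation_eq_zero_of_eval_eq_zero_of_kernelIsNil
    (hK : ∀ c : FormalRep, eval c = 0 → IsNilpotent (toFormalPeriod c))
    {R : Type*} [CommRing R] [IsReduced R] (χ : FormalRep →+ R)
    (hrel : ∀ c ∈ relations, χ c = 0) (hmul : ∀ a b : FormalRep, χ (a * b) = χ a * χ b)
    {c : FormalRep} (hc : eval c = 0) : χ c = 0 := by
  obtain ⟨n, hn⟩ := hK c hc
  cases n with
  | zero => rw [pow_zero] at hn; exact absurd hn one_ne_zero
  | succ k =>
    obtain ⟨d, hd⟩ := toFormalPeriod_surjective (toFormalPeriod c ^ (k + 1))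
    have hdrel : d ∈ relations := by rw [← toFormalPeriod_eq_zero_iff, hd, hn]
    have hpow : χ c ^ (k + 1) = 0 := by
      rw [← realisation_apply_of_toFormalPeriod_eq_pow χ hrel hmul c k d hd]
      exact hrel d hdrel
    exact IsReduced.eq_zero _ ⟨k + 1, hpow⟩

/-- **Realisation form of the irreducibility half**: `KernelIsNil` iff every FIELD-valued
realisation `χ : P → K` kills `ker evalP` (←: apply it to `P → Frac(P/𝔭)` for every prime `𝔭`).
Compare `reducedPeriodRing_iff_fieldPoints_separate` (`Negative/RingForms.lean`): the crux is the
complementary statement that field points SEPARATE elements. [folklore] -/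
theorem kernelIsNil_iff_fieldPoints_factor :
    (∀ c : FormalRep, eval c = 0 → IsNilpotent (toFormalPeriod c)) ↔
      ∀ (K : Type) [Field K] (χ : FormalPeriodRing →+* K) (x : FormalPeriodRing),
        evalP x = 0 → χ x = 0 := by
  constructor
  · intro h K _ χ x hx
    exact ker_evalP_le_ker_of_kernelIsNil h χ (RingHom.mem_ker.mpr hx)
  · intro h
    rw [kernelIsNil_iff_ker_le_primes]
    intro J hJ x hx
    haveI := hJ
    have h1 := h (FractionRing (FormalPeriodRing ⧸ J))
      ((algebraMap (FormalPeriodRing ⧸ J) (FractionRing (FormalPeriodRing ⧸ J))).comp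
        (Ideal.Quotient.mk J)) x (RingHom.mem_ker.mp hx)
    rw [RingHom.comp_apply,
      ← map_zero (algebraMap (FormalPeriodRing ⧸ J) (FractionRing (FormalPeriodRing ⧸ J))),
      (IsFractionRing.injective (FormalPeriodRing ⧸ J) (FractionRing (FormalPeriodRing ⧸ J))).eq_iff,
      Ideal.Quotient.eq_zero_iff_mem] at h1
    exact h1

/-- The two halves together, in realisation language: Conjecture 1 holds iff field-valued
realisations of the rules factor through the value AND separate formal periods. [folklore] -/
theorem kzKernelConjecture_iff_fieldPoints :
    KZKernelConjecture ↔
      (∀ (K : Type) [Field K] (χ : FormalPeriodRing →+* K) (x : FormalPeriodRing),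
        evalP x = 0 → χ x = 0) ∧
      (∀ x : FormalPeriodRing, x ≠ 0 →
        ∃ (K : Type) (_ : Field K) (χ : FormalPeriodRing →+* K), χ x ≠ 0) := by
  rw [kzKernelConjecture_iff_kernelIsNil_and_reduced, kernelIsNil_iff_fieldPoints_factor,
    reducedPeriodRing_iff_fieldPoints_separate]

/-! ### The two halves are abstractly independent -/

/-- **Irreducibility without reducedness**: a commutative ring with a surjective evaluation
character in which EVERY value-zero element is nilpotent (indeed square-zero) but which is not
reduced — the dual numbers `ℚ[ε]`, `ev` = standard part. [folklore] -/
theorem dualNumber_model :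
    ∃ (R : Type) (_ : CommRing R) (ev : R →+* ℚ), Function.Surjective ev ∧
      (∀ x : R, ev x = 0 → x * x = 0) ∧ ¬ IsReduced R := by
  refine ⟨DualNumber ℚ, inferInstance, (TrivSqZeroExt.fstHom ℚ ℚ ℚ).toRingHom, ?_, ?_, ?_⟩
  · intro q
    exact ⟨TrivSqZeroExt.inl q, by simp⟩
  · intro x hx
    have hx' : x.fst = 0 := by simpa using hx
    have hxe : x = TrivSqZeroExt.inr x.snd := by
      ext <;> simp [hx']
    rw [hxe]
    exact TrivSqZeroExt.inr_mul_inr ℚ x.snd x.snd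
  · intro hred
    have hnil : IsNilpotent (DualNumber.eps : DualNumber ℚ) :=
      ⟨2, by rw [pow_two]; exact DualNumber.eps_mul_eps⟩
    have h0 := hred.eq_zero _ hnil
    have := congrArg TrivSqZeroExt.snd h0
    simp at this

/-- **Reducedness without irreducibility**: a REDUCED commutative ring with a surjective
evaluation character and a value-zero element which is not nilpotent (it is idempotent) —
`ℚ × ℚ`, `ev = fst`, `x = (0, 1)`; here `Spec` has two points and the evaluation sees one. So the
crux alone implies no instance of the irreducibility half, and conversely. [folklore] -/
theorem product_model :
    ∃ (R : Type) (_ : CommRing R) (ev : R →+* ℚ) (x : R), Function.Surjective ev ∧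
      IsReduced R ∧ ev x = 0 ∧ ¬ IsNilpotent x ∧ x * x = x := by
  refine ⟨ℚ × ℚ, inferInstance, RingHom.fst ℚ ℚ, (0, 1), ?_, inferInstance, by simp, ?_, by simp⟩
  · intro q
    exact ⟨(q, 0), by simp⟩
  · rintro ⟨n, hn⟩
    have := congrArg Prod.snd hn
    simp at this

/-- **Idempotents are invisible to the crux**: a non-trivial idempotent `e` of `P` (`e² = e`,
`e ≠ 0, 1`) would refute the summit (`evalP e ∈ {0,1}` forces `e ∼ 0` or `e ∼ 1` under the
kernel conjecture) but is consistent with `ReducedPeriodRing` (`product_model`). Recorded as: under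
the kernel conjecture `P` has only the trivial idempotents. [folklore] -/
theorem idempotent_trivial_of_kernel (hK : KZKernelConjecture) (e : FormalPeriodRing)
    (he : e * e = e) : e = 0 ∨ e = 1 := by
  have hinj := kzKernelConjecture_iff_injective_evalP.mp hK
  have hv : evalP e * evalP e = evalP e := by rw [← map_mul, he]
  have hv' : evalP e = 0 ∨ evalP e = 1 := by
    have : evalP e * (evalP e - 1) = 0 := by rw [mul_sub, mul_one, hv, sub_self]
    rcases mul_eq_zero.mp this with h | h
    · exact Or.inl h
    · exact Or.inr (sub_eq_zero.mp h)
  rcases hv' with h | h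
  · left; apply hinj; rw [h, map_zero]
  · right; apply hinj; rw [h, map_one]

end Summit.KontsevichZagierPeriods.KontsevichZagierPeriods.ReducedPeriodRingNegative
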